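import Summits.QuantumFields.BalabanUV.Beta.D1BFx.TruncatedAlgebraNorms
import Summits.QuantumFields.BalabanUV.Beta.D1BFx.WeightedRowSumNorm
import Summits.QuantumFields.BalabanUV.Beta.D1BFx.WordRecordingAlgebra
import Summits.QuantumFields.BalabanUV.Beta.SymAveragingMixedJetStructure

/-!
# `BalabanUV.Beta.D1BFx.SymMixedJetRecording` — road «BF-x» for binder row D1, junction (J1), «SYMMIX-MASS» FILE 4 of 5: **NATURALITY OF an1's SYMMETRISED MIXED
# JET, THE TABLES AS ENTRIES OF ONE RECORDING-ALGEBRA ELEMENT (`a_sym(u,x,v) = X_{•,(u,v,x)}`), AND THE WEIGHTED NORMS OF THE RECORDING LETTERS (`≤ t`) WITH THE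
# TOP-ROW EXTRACTION `t³·Σ_w |M_{•,(w)}| ≤ ‖M‖_t`**

HONEST DEPENDENCY (cell records, verbatim): «continuum YM on T⁴ ⇐ BetaPertH ∧ nine spine estimates (0/9 proved); BetaPertH ⇐ (D1) ∧ (D4) ∧
CAP+tail; G-an2-4 gates asym, D1 and NE2/3/4.»  HONEST FRAMING (cell contract, verbatim): «discharging `BetaPertH` makes Bałaban's UV stability
UNCONDITIONAL — a real constructive-QFT result; it is NOT the continuum limit and NOT the Clay problem.»  THIS MODULE DISCHARGES NOTHING of the
wall: [folklore] bookkeeping BY NAME over an1's `symMjetAt ∕ symPhiMAt ∕ map_symPhiGAt ∕ symATab ∕ symApTab` (`SymAveragingMixedJetWords ∕ …Structure`), lit node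
12 ∕ 12b (`mapDual ∕ Tau.mk ∕ ι ∕ Zf ∕ Zb ∕ Gm ∕ Gmb ∕ map_logT ∕ map_invT ∕ single ∕ E`) and FILES 1–3; DEFINITION lane for ONE definition (the level weights
`lvW t j := t ^ lv j`), 0 cite, 0 `def … : Prop`, 0 sorry; nothing of an1's restated, NO table added, NO value asserted.  It prices NO word and proves NO
(1.22) row; 0 root-level binders of row D1 discharged (hW ∕ hR-sockets ∕ hSX-socket ∕ D1Tel ∕ D1Rep = 0); (J1) ONE OPEN ROW; (K) NOT closed; NOT D1, NEVER
«G-an2-4 closed», NOT `BetaPertH`, NOT continuum, NOT Clay.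

ABSOLUTE RULE (cell charter, verbatim): «No internally-minted statement may enter as a cited fact. Every hypothesis is either kernel-proved in
this package or a verbatim quotation of a PUBLISHED theorem with page reference. The manuscript(s) under audit are NOT citable for their own
disputed steps — they are the thing under adjudication; programme-internal (2001/route/tribunal) claims are never citable.»

CONTENT ([folklore] throughout).
* §1 NATURALITY under `ψ : 𝔸 →ₐ[ℚ] 𝔸′`: `mapDual2_mk ∕ c11_mapDual2 ∕ mapDual2_ι ∕ mapDual2_Zf ∕ mapDual2_Zb ∕ mapDual3_Gm ∕ mapDual3_Gmb ∕ mapDual3_symPhiMAt`,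
  **`symMjetAt_map : ψ (symMjetAt ℚ ρ W V B L μ y) = symMjetAt ℚ ρ (ψ∘W) (ψ∘V) (ψ∘B) L μ y`** (an1's killing-homomorphism pattern with a general `ψ`).
* §2 **`symATab_eq_entry`**: `a_sym(w₁, w₃, w₂) = X_{•,(w₁,w₂,w₃)}`, `X := symMjetAt ℚ ρ recW rec12 rec23 L μ 0 ∈ recAlg (SB d L)` (through `theta w`, FILE 3), and
  **`symApTab_eq_entry`**: `a′_sym(w₁, w₂, w₃) = X′_{•,(w₁,w₂,w₃)}`, `X′ := symMjetAt ℚ ρ recW rec23 rec12 L μ 0` — ANY root `ρ`, any `μ`.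
* §3 `lvW`, `lvW_pos`, **`mnorm_m01_le ∕ _m12_le ∕ _m23_le`** (`≤ t`), **`sum_three_le`**
  (`t³·Σ_{w ∈ S³} |M_{•,(w)}| ≤ ‖M‖_t`), `mnorm_recW_le ∕ _rec12_le ∕ _rec23_le` (`≤ t`, `0` off the box).
NOT HERE: the seminorm chain through the (0.4) averaging and the letter `symMixAbs_le` (FILE 5 `SymMixedTableMass`).
v1.1 (gen 31): ONE scoped `set_option synthInstance.maxHeartbeats 40000 in` before `symMjetAt_map` (heartbeat-margin robustness for the hub build; every
declaration, statement and proof byte-identical to v1 p374322).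
Unit `b2b-balaban-beta-d1-formalise-leaf-04` (gen 29), D1 formalisation swarm LEAF PROVER 04, road «BF-x» supplier; INTENT I-leaf04-g29-1 «SYMMIX-MASS»
(journal), taking the OWNER d1-p2 g25's located WANTED «the n-law of `symMixAbs`» (W-g25-9 (a)).  Not in print; our bookkeeping.  No existing file touched.
-/

noncomputable section

open Finset
open scoped BigOperators
open Literature.MathematicalPhysics.QuantumFieldTheory.Balaban1983to89.Beta
open Literature.MathematicalPhysics.QuantumFieldTheory.Balaban1983to89.Beta.AffineAveraging
open Literature.MathematicalPhysics.QuantumFieldTheory.Balaban1983to89.Beta.AveragingHessianKernels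
open Literature.MathematicalPhysics.QuantumFieldTheory.Balaban1983to89.Beta.AveragingThirdJet
open Literature.MathematicalPhysics.QuantumFieldTheory.Balaban1983to89.Beta.AveragingThirdJet.Tau
open Literature.MathematicalPhysics.QuantumFieldTheory.Balaban1983to89.Beta.AveragingMixedJetTables
open Summit.QuantumFields.BalabanUV.Beta.SymAveragingMixedJetTables
open Summit.QuantumFields.BalabanUV.Beta.D1BFx.TruncatedAlgebraNorms
open Summit.QuantumFields.BalabanUV.Beta.D1BFx.WeightedRowSumNorm
open Summit.QuantumFields.BalabanUV.Beta.D1BFx.WordRecordingAlgebra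

namespace Summit.QuantumFields.BalabanUV.Beta.D1BFx.SymMixedJetRecording

/-! ## §1 Naturality of an1's symmetrised mixed jet under `ℚ`-algebra homomorphisms -/

section Naturality

variable {d : ℕ} {𝔸 𝔸' : Type*} [Ring 𝔸] [Algebra ℚ 𝔸] [Ring 𝔸'] [Algebra ℚ 𝔸'] (ψ : 𝔸 →ₐ[ℚ] 𝔸')

/-- [folklore] `mapDual²` acts componentwise on `Tau.mk`. -/
theorem mapDual2_mk (a b c e : 𝔸) : mapDual (mapDual ψ) (Tau.mk a b c e) = Tau.mk (ψ a) (ψ b) (ψ c) (ψ e) := rfl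

/-- [folklore] `mapDual²` reads the `τ₁τ₂`-coefficient through `ψ`. -/
theorem c11_mapDual2 (q : Tau 𝔸) : c11 (mapDual (mapDual ψ) q) = ψ (c11 q) := rfl

/-- [folklore] `mapDual²` on the scalars `ι`. -/
theorem mapDual2_ι (b : 𝔸) : mapDual (mapDual ψ) (ι b) = ι (ψ b) := by
  simp only [ι, mapDual2_mk, map_zero]

/-- [folklore] `mapDual²` on the symmetric exponential letter `Z_f`. -/
theorem mapDual2_Zf (W V : Form1 d 𝔸) (κ : Fin d) (x : Fin d → ℤ) :
    mapDual (mapDual ψ) (Zf ℚ W V κ x) = Zf ℚ (fun κ x => ψ (W κ x)) (fun κ x => ψ (V κ x)) κ x := by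
  simp only [Zf, mapDual2_mk, map_one, map_smul, map_add, map_mul]

/-- [folklore] `mapDual²` on the backward letter `Z_f⁻¹`. -/
theorem mapDual2_Zb (W V : Form1 d 𝔸) (κ : Fin d) (x : Fin d → ℤ) :
    mapDual (mapDual ψ) (Zb ℚ W V κ x) = Zb ℚ (fun κ x => ψ (W κ x)) (fun κ x => ψ (V κ x)) κ x := by
  simp only [Zb, mapDual2_mk, map_one, map_neg, map_smul, map_add, map_mul]

/-- [folklore] `mapDual³` on the forward transporter of the mixed chart. -/
theorem mapDual3_Gm (W V B : Form1 d 𝔸) (κ : Fin d) (x : Fin d → ℤ) :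
    mapDual (mapDual (mapDual ψ)) (Gm ℚ W V B κ x)
      = Gm ℚ (fun κ x => ψ (W κ x)) (fun κ x => ψ (V κ x)) (fun κ x => ψ (B κ x)) κ x := by
  apply TrivSqZeroExt.ext <;> simp [Gm, mapDual2_Zf, mapDual2_ι, map_mul]

/-- [folklore] `mapDual³` on the backward transporter of the mixed chart. -/
theorem mapDual3_Gmb (W V B : Form1 d 𝔸) (κ : Fin d) (x : Fin d → ℤ) :
    mapDual (mapDual (mapDual ψ)) (Gmb ℚ W V B κ x)
      = Gmb ℚ (fun κ x => ψ (W κ x)) (fun κ x => ψ (V κ x)) (fun κ x => ψ (B κ x)) κ x := by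
  apply TrivSqZeroExt.ext <;> simp [Gmb, mapDual2_Zb, mapDual2_ι, map_mul, map_neg]

/-- [folklore] NATURALITY of the symmetrised mixed averaging. -/
theorem mapDual3_symPhiMAt (ρ : Fin d → ℤ) (W V B : Form1 d 𝔸) (L : ℕ) (μ : Fin d) (y : Fin d → ℤ) :
    mapDual (mapDual (mapDual ψ)) (symPhiMAt ℚ ρ W V B L μ y)
      = symPhiMAt ℚ ρ (fun κ x => ψ (W κ x)) (fun κ x => ψ (V κ x)) (fun κ x => ψ (B κ x)) L μ y := by
  rw [symPhiMAt, symPhiMAt, map_symPhiGAt]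
  simp only [mapDual3_Gm, mapDual3_Gmb]

set_option synthInstance.maxHeartbeats 40000 in
/-- [folklore] **NATURALITY OF an1's SYMMETRISED MIXED JET** under `ℚ`-algebra homomorphisms: `ψ (M^{ρ,sym}_b(W,V;B)) = M^{ρ,sym}_b(ψW, ψV; ψB)`.
(v1.1: the instance search for `Mul (Rho 𝔸′)` on the `map_logT` line needs between 17 000 and 18 000 of the default 20 000 `synthInstance` heartbeats on the
check farm — a 10–15 % margin, the hub `lake build`'s measured overhead class; the scoped option above doubles the budget. Statement and proof unchanged.) -/
theorem symMjetAt_map (ρ : Fin d → ℤ) (W V B : Form1 d 𝔸) (L : ℕ) (μ : Fin d) (y : Fin d → ℤ) :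
    ψ (symMjetAt ℚ ρ W V B L μ y)
      = symMjetAt ℚ ρ (fun κ x => ψ (W κ x)) (fun κ x => ψ (V κ x)) (fun κ x => ψ (B κ x)) L μ y := by
  have h0 : (fun κ x => ψ ((0 : Form1 d 𝔸) κ x)) = (0 : Form1 d 𝔸') := by funext κ x; simp
  have e := congrArg (fun Z : Rho 𝔸' => c11 Z.snd)
    (map_logT (mapDual (mapDual (mapDual ψ))) (symPhiMAt ℚ ρ W V B L μ y * invT (symPhiMAt ℚ ρ 0 0 B L μ y)))
  simp only [map_mul, map_invT, mapDual3_symPhiMAt, h0, snd_mapDual, c11_mapDual2] at e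
  rw [symMjetAt, symMjetAt]; exact e

end Naturality

/-! ## §2 The tables as entries of ONE element of the word-recording algebra -/

section Identification

variable {d : ℕ} (ρ : Fin d → ℤ) (L : ℕ) (μ : Fin d)

/-- [folklore] **`a_sym(u, x, v) = X_{•,(u,v,x)}`** for `X := M^{ρ,sym}_b(W♭, V♭; B♭)` in the recording algebra. -/
theorem symATab_eq_entry (w : SB d L × SB d L × SB d L) :
    (symATab ρ L μ 0 (w.1 : Bond d) (w.2.2 : Bond d) (w.2.1 : Bond d) : ℚ)
      = ((symMjetAt ℚ ρ (recW d L) (rec12 d L) (rec23 d L) L μ 0 : recAlg (SB d L)) : Matrix (Idx (SB d L)) (Idx (SB d L)) ℚ)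
          Idx.nil (Idx.three w.1 w.2.1 w.2.2) := by
  have e := symMjetAt_map (theta w) ρ (recW d L) (rec12 d L) (rec23 d L) L μ 0
  rw [theta_recW, theta_rec12, theta_rec23] at e
  have e03 := congrFun (congrFun e 0) 3
  rw [theta_apply] at e03
  rw [symATab, ← e03]; rfl

/-- [folklore] **`a′_sym(u, v, x) = X′_{•,(u,v,x)}`** for `X′ := M^{ρ,sym}_b(W♭, (2→3)♭; (1→2)♭)`. -/
theorem symApTab_eq_entry (w : SB d L × SB d L × SB d L) :
    (symApTab ρ L μ 0 (w.1 : Bond d) (w.2.1 : Bond d) (w.2.2 : Bond d) : ℚ)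
      = ((symMjetAt ℚ ρ (recW d L) (rec23 d L) (rec12 d L) L μ 0 : recAlg (SB d L)) : Matrix (Idx (SB d L)) (Idx (SB d L)) ℚ)
          Idx.nil (Idx.three w.1 w.2.1 w.2.2) := by
  have e := symMjetAt_map (theta w) ρ (recW d L) (rec23 d L) (rec12 d L) L μ 0
  rw [theta_recW, theta_rec12, theta_rec23] at e
  have e03 := congrFun (congrFun e 0) 3
  rw [theta_apply] at e03
  rw [symApTab, ← e03]; rfl

end Identification

/-! ## §3 The weighted norms of the recording letters and the top-row extraction -/

section Letters

variable {S : Type*} [Fintype S] [DecidableEq S]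

open Idx

/-- [our object] The level weights `ω_t j := t ^ lv j`. -/
def lvW (t : ℝ) : Idx S → ℝ := fun j => t ^ j.lv

omit [Fintype S] [DecidableEq S] in
/-- [folklore] The level weights are positive for `0 < t`. -/
theorem lvW_pos {t : ℝ} (ht : 0 < t) (j : Idx S) : 0 < lvW t j := pow_pos ht _

/-- [folklore] **`‖m01 f‖_t ≤ t`**: the `0 → 1` letter has one unit entry one level up. -/
theorem mnorm_m01_le {t : ℝ} (ht : 0 < t) (f : S) : mnorm (lvW t) (m01 f) ≤ t := by
  refine Finset.sup'_le _ _ fun j _ => ?_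
  unfold rowW
  cases j with
  | nil =>
    rw [Fintype.sum_eq_single (Idx.one f) (fun k hk => by cases k <;> simp_all [m01])]
    simp [m01, lvW, lv]
  | one a => simp [m01]; exact ht.le
  | two a b => simp [m01]; exact ht.le
  | three a b c => simp [m01]; exact ht.le

/-- [folklore] **`‖m12 f‖_t ≤ t`**. -/
theorem mnorm_m12_le {t : ℝ} (ht : 0 < t) (f : S) : mnorm (lvW t) (m12 f) ≤ t := by
  refine Finset.sup'_le _ _ fun j _ => ?_
  unfold rowW
  cases j with
  | nil => simp [m12]; exact ht.le
  | one u =>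
    rw [Fintype.sum_eq_single (Idx.two u f) (fun k hk => by cases k <;> simp_all [m12])]
    simp [m12, lvW, lv, pow_succ, ht.ne']
  | two a b => simp [m12]; exact ht.le
  | three a b c => simp [m12]; exact ht.le

/-- [folklore] **`‖m23 f‖_t ≤ t`**. -/
theorem mnorm_m23_le {t : ℝ} (ht : 0 < t) (f : S) : mnorm (lvW t) (m23 f) ≤ t := by
  refine Finset.sup'_le _ _ fun j _ => ?_
  unfold rowW
  cases j with
  | nil => simp [m23]; exact ht.le
  | one u => simp [m23]; exact ht.le
  | two u v =>
    rw [Fintype.sum_eq_single (Idx.three u v f) (fun k hk => by cases k <;> simp_all [m23])]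
    simp [m23, lvW, lv, pow_succ, ht.ne']
  | three a b c => simp [m23]; exact ht.le

/-- [folklore] **EXTRACTION OF THE TOP ROW**: `t³ · Σ_{w ∈ S³} |M_{•,(w)}| ≤ ‖M‖_t`. -/
theorem sum_three_le {t : ℝ} (ht : 0 < t) (M : Matrix (Idx S) (Idx S) ℚ) :
    t ^ 3 * ∑ w : S × S × S, |(M Idx.nil (Idx.three w.1 w.2.1 w.2.2) : ℝ)| ≤ mnorm (lvW t) M := by
  classical
  have hinj : Function.Injective (fun w : S × S × S => (Idx.three w.1 w.2.1 w.2.2 : Idx S)) := by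
    rintro ⟨a, b, c⟩ ⟨a', b', c'⟩ h
    simp only [Idx.three.injEq] at h
    obtain ⟨rfl, rfl, rfl⟩ := h; rfl
  have h := sum_filter_le_mnorm (lvW_pos ht) M Idx.nil ((Finset.univ : Finset (S × S × S)).image fun w => Idx.three w.1 w.2.1 w.2.2)
  rw [Finset.sum_image fun a _ b _ hab => hinj hab] at h
  rw [Finset.mul_sum]
  refine (le_of_eq (Finset.sum_congr rfl fun w _ => ?_)).trans h
  simp [lvW, lv]

end Letters

section Lattice

variable {d L : ℕ}

/-- [folklore] The norms of the letter forms: `≤ t` everywhere (`0` off the box). -/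
theorem mnorm_recW_le {t : ℝ} (ht : 0 < t) (κ : Fin d) (x : Fin d → ℤ) :
    mnorm (lvW t) (recW d L κ x : Matrix (Idx (SB d L)) (Idx (SB d L)) ℚ) ≤ t := by
  unfold recW; split_ifs with h
  · exact mnorm_m01_le ht _
  · rw [ZeroMemClass.coe_zero, mnorm_zero (lvW_pos ht)]; exact ht.le

/-- [folklore] -/
theorem mnorm_rec12_le {t : ℝ} (ht : 0 < t) (κ : Fin d) (x : Fin d → ℤ) :
    mnorm (lvW t) (rec12 d L κ x : Matrix (Idx (SB d L)) (Idx (SB d L)) ℚ) ≤ t := by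
  unfold rec12; split_ifs with h
  · exact mnorm_m12_le ht _
  · rw [ZeroMemClass.coe_zero, mnorm_zero (lvW_pos ht)]; exact ht.le

/-- [folklore] -/
theorem mnorm_rec23_le {t : ℝ} (ht : 0 < t) (κ : Fin d) (x : Fin d → ℤ) :
    mnorm (lvW t) (rec23 d L κ x : Matrix (Idx (SB d L)) (Idx (SB d L)) ℚ) ≤ t := by
  unfold rec23; split_ifs with h
  · exact mnorm_m23_le ht _
  · rw [ZeroMemClass.coe_zero, mnorm_zero (lvW_pos ht)]; exact ht.le

end Lattice

end Summit.QuantumFields.BalabanUV.Beta.D1BFx.SymMixedJetRecording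

end
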